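import Mathlib.Tactic
import HarnessLib
import HarnessLib.Audit.Tags
import Summits.CriticalPhenomena.PercolationContinuityZ3.Theorems.PercNearOneGluingNoHeavyLowerTailSahiAntichainSplitSeven
import Summits.CriticalPhenomena.PercolationContinuityZ3.Theorems.PercNearOneGluingNoHeavyLowerTailSahiAntichainThreeCoFour

/-!
# Antichains, meets plus joins: two members above a three-member co-sunflower with at most one new meet give three new joins (statement C)

Support file (seat `prim-masterthm-p1`, gen 37; `--supports stmt-CriticalPhenomena-4575`).  No `sorry`, no new definitions, standard
axioms.  Memo `run/shared/lean/prim/prim-masterthm/FROM-prim-masterthm-p1-g37-LINEAR-REDUCTION.md` §8.3/§9.1.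

SETTING: L3 (`f(5) ≥ 10`) ⟸ H23 ⟸ (S), (C), (F) (`h23_of`, `…TwoThreeA`).  This file proves **(C)**: at a point with exactly two members
`a, a'` above and a three-member CO-SUNFLOWER below (`bᵢ ∪ bⱼ = U`), `#newMeets ≤ 1 ⟹ #newJoins ≥ 3` (this is tight: the `C([4],2)`
blow-ups minus a member have `newMeets = 1`, `newJoins = 3` at a core point).

PROOF.  (i) A member `g` above cannot contain two co-petals `U \\ bⱼ`, `U \\ bₖ`: it would then miss a point of the core `b₁ ∩ b₂ ∩ b₃`
(else `g ⊇ b_m`), so its three cross meets would be new, and they are pairwise distinct — three new meets.  (ii) Hence each row has three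
distinct cross joins (a non-swallowed co-petal point separates `g ∪ bⱼ` from `g ∪ bₖ`).  (iii) The two rows are not equal as sets: a
coincidence `a ∪ b = a' ∪ b'` with `b ≠ b'` makes `a` swallow `U \\ b` and `a'` swallow `U \\ b'`, and chasing the other members through the
equality of the rows forces either a second swallowed co-petal or `a △ a' ⊆ b` for every `b`, which yields two distinct new meets.  (iv) Two
distinct 3-sets of joins cover at least four sets, at most one of which is `a ∪ a'`.
HONEST FRAMING: unconditional; (F), L4 and hence L3-in-Lean, V5 remain OPEN. [this work]
-/

namespace Summit.CriticalPhenomena.PercolationContinuityZ3.Theorems.SahiColouredDaykin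

open Finset

variable {α : Type*} [DecidableEq α]

/-- In a three-member family, three distinct members exhaust it. [this work] -/
theorem mem_three_cover {A : Finset (Finset α)} (h3 : #A = 3) {x y z : Finset α} (hx : x ∈ A) (hy : y ∈ A) (hz : z ∈ A)
    (hxy : x ≠ y) (hxz : x ≠ z) (hyz : y ≠ z) : ∀ e ∈ A, e = x ∨ e = y ∨ e = z := by
  have hsub : ({x, y, z} : Finset (Finset α)) ⊆ A := by
    intro e he
    simp only [mem_insert, mem_singleton] at he
    rcases he with rfl | rfl | rfl <;> assumption
  have hcard : #({x, y, z} : Finset (Finset α)) = 3 := by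
    rw [card_insert_of_notMem, card_pair hyz]
    simp only [mem_insert, mem_singleton, not_or]; exact ⟨hxy, hxz⟩
  have hEq : ({x, y, z} : Finset (Finset α)) = A := eq_of_subset_of_card_le hsub (by omega)
  intro e he
  rw [← hEq] at he
  simp only [mem_insert, mem_singleton] at he
  exact he

/-- **(C)**: two members above, a three-member co-sunflower below, at most one new meet ⟹ at least three new joins. [this work] -/
theorem three_le_card_newJoins_of_two_cosunflower_three {P : Finset (Finset α)} {r : α} {U : Finset α}
    (hanti : IsAntichain (· ⊆ ·) (P : Set (Finset α))) (h2 : #(above P r) = 2) (h3 : #(below P r) = 3)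
    (hU : ∀ b ∈ below P r, ∀ b' ∈ below P r, b ≠ b' → b ∪ b' = U) (hx : #(newMeets P r) ≤ 1) :
    3 ≤ #(newJoins P r) := by
  obtain ⟨a, a', hne, hA⟩ := card_eq_two.1 h2
  have ha : a ∈ above P r := by rw [hA]; simp
  have ha' : a' ∈ above P r := by rw [hA]; simp
  obtain ⟨haP, hra⟩ := mem_above_iff.1 ha
  obtain ⟨ha'P, hra'⟩ := mem_above_iff.1 ha'
  have hJ : joins (above P r) = {a ∪ a'} := by rw [hA, joins_pair hne]
  have hB2 : 1 < #(below P r) := by omega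
  obtain ⟨b₁, b₂, b₃, h12, h13, h23, hB⟩ := card_eq_three.1 h3
  have mem : ∀ b ∈ below P r, b = b₁ ∨ b = b₂ ∨ b = b₃ := by
    intro b hb; rw [hB, mem_insert, mem_insert, mem_singleton] at hb; exact hb
  have hb₁ : b₁ ∈ below P r := by rw [hB]; simp
  have hb₂ : b₂ ∈ below P r := by rw [hB]; simp
  have hb₃ : b₃ ∈ below P r := by rw [hB]; simp
  have uniq : ∀ {Z Z' : Finset α}, Z ∈ newMeets P r → Z' ∈ newMeets P r → Z = Z' :=
    fun hZ hZ' => card_le_one.1 hx _ hZ _ hZ'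
  -- old meets contain the core point set `b₁ ∩ b₂ ∩ b₃`
  have core_sub_old : ∀ {Z : Finset α}, Z ∈ meets (below P r) → b₁ ∩ b₂ ∩ b₃ ⊆ Z := by
    intro Z hZ
    obtain ⟨d, hd, d', hd', _, rfl⟩ := mem_meets_iff.1 hZ
    intro x hx
    simp only [mem_inter] at hx
    have hxall : ∀ {e : Finset α}, e ∈ below P r → x ∈ e := by
      intro e he; rcases mem e he with rfl | rfl | rfl
      · exact hx.1.1
      · exact hx.1.2
      · exact hx.2
    exact mem_inter.2 ⟨hxall hd, hxall hd'⟩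
  -- (i) no member above swallows two co-petals
  have swallow2 : ∀ {g bj bk bm : Finset α}, g ∈ above P r → bj ∈ below P r → bk ∈ below P r → bm ∈ below P r →
      bj ≠ bk → bj ≠ bm → bk ≠ bm → U \ bj ⊆ g → U \ bk ⊆ g → False := by
    intro g bj bk bm hg hbj hbk hbm hjk hjm hkm hsj hsk
    obtain ⟨hgP, hrg⟩ := mem_above_iff.1 hg
    -- a core point outside `g` (else `bm ⊆ g`)
    have hcore : ¬ b₁ ∩ b₂ ∩ b₃ ⊆ g := by
      intro hsub
      have hbmg : bm ⊆ g := by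
        intro x hx
        have hxU : x ∈ U := subset_of_below_cosunflower hU hB2 hbm hx
        have cover := mem_three_cover h3 hbj hbk hbm hjk hjm hkm
        by_cases hxj : x ∈ bj
        · by_cases hxk : x ∈ bk
          · apply hsub
            have hxall : ∀ {e : Finset α}, e ∈ below P r → x ∈ e := by
              intro e he
              rcases cover e he with rfl | rfl | rfl
              · exact hxj
              · exact hxk
              · exact hx
            simp only [mem_inter]
            exact ⟨⟨hxall hb₁, hxall hb₂⟩, hxall hb₃⟩
          · exact hsk (mem_sdiff.2 ⟨hxU, hxk⟩)
        · exact hsj (mem_sdiff.2 ⟨hxU, hxj⟩)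
      have hne' : bm ≠ g := by rintro rfl; exact (mem_below_iff.1 hbm).2 hrg
      exact hanti (mem_coe.2 (below_subset P r hbm)) (mem_coe.2 hgP) hne' hbmg
    obtain ⟨ρ, hρ, hρg⟩ := not_subset.1 hcore
    -- all cross meets of `g` are new
    have newg : ∀ {b : Finset α}, b ∈ below P r → g ∩ b ∈ newMeets P r := by
      intro b hb
      rw [inter_mem_newMeets_iff hg hb]
      intro hold
      exact hρg (mem_inter.1 (core_sub_old hold hρ)).1
    -- `g ∩ bj ⊇ U \ bk` while `g ∩ bk` misses it: distinct new meets
    obtain ⟨p, hp⟩ := sdiff_nonempty_of_below_cosunflower hanti hU hB2 hbk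
    have hpj : p ∈ bj := sdiff_subset_of_below_cosunflower hU hbk hbj hjk.symm hp
    have h := uniq (newg hbj) (newg hbk)
    have : p ∈ g ∩ bk := by rw [← h]; exact mem_inter.2 ⟨hsk hp, hpj⟩
    exact (mem_sdiff.1 hp).2 (mem_inter.1 this).2
  -- (ii) a non-swallowed co-petal separates the cross joins; each row has three distinct cross joins
  have rowdist : ∀ {g b b' : Finset α}, g ∈ above P r → b ∈ below P r → b' ∈ below P r → b ≠ b' → g ∪ b ≠ g ∪ b' := by
    intro g b b' hg hb hb' hbb' heq
    -- the third member
    obtain ⟨c, hc, hcb, hcb'⟩ := exists_third (by omega : 3 ≤ #(below P r)) b b'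
    -- if `U \ b ⊄ g`, a point of it lies in `b'` but not in `g ∪ b`
    have sw : ∀ {e e' : Finset α}, e ∈ below P r → e' ∈ below P r → e ≠ e' → g ∪ e = g ∪ e' → U \ e ⊆ g := by
      intro e e' he he' hee' hee x hx
      have hxe' : x ∈ e' := sdiff_subset_of_below_cosunflower hU he he' hee' hx
      have : x ∈ g ∪ e := by rw [hee]; exact mem_union_right _ hxe'
      rcases mem_union.1 this with h | h
      · exact h
      · exact absurd h (mem_sdiff.1 hx).2
    exact swallow2 hg hb hb' hc hbb' hcb.symm hcb'.symm (sw hb hb' hbb' heq) (sw hb' hb hbb'.symm heq.symm)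
  -- separating points of `a`, `a'`
  have naa' : ¬ a ⊆ a' := hanti (mem_coe.2 haP) (mem_coe.2 ha'P) hne
  have na'a : ¬ a' ⊆ a := hanti (mem_coe.2 ha'P) (mem_coe.2 haP) hne.symm
  obtain ⟨s, hsa, hsa'⟩ := not_subset.1 naa'
  obtain ⟨t, hta', hta⟩ := not_subset.1 na'a
  -- (iii-a) if `a △ a'` lies inside every member below, there are two distinct new meets
  have notAllD : ¬ (∀ b ∈ below P r, a ∪ b = a' ∪ b) := by
    intro hall
    have hsb : ∀ {b : Finset α}, b ∈ below P r → s ∈ b := by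
      intro b hb
      have : s ∈ a' ∪ b := by rw [← hall b hb]; exact mem_union_left _ hsa
      rcases mem_union.1 this with h | h
      · exact absurd h hsa'
      · exact h
    have htb : ∀ {b : Finset α}, b ∈ below P r → t ∈ b := by
      intro b hb
      have : t ∈ a ∪ b := by rw [hall b hb]; exact mem_union_left _ hta'
      rcases mem_union.1 this with h | h
      · exact absurd h hta
      · exact h
    have hZ : a ∩ b₁ ∈ newMeets P r := by
      rw [inter_mem_newMeets_iff ha hb₁]
      intro hold
      obtain ⟨d, hd, d', hd', _, heq⟩ := mem_meets_iff.1 hold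
      have : t ∈ a ∩ b₁ := by rw [heq]; exact mem_inter.2 ⟨htb hd, htb hd'⟩
      exact hta (mem_inter.1 this).1
    have hZ' : a' ∩ b₁ ∈ newMeets P r := by
      rw [inter_mem_newMeets_iff ha' hb₁]
      intro hold
      obtain ⟨d, hd, d', hd', _, heq⟩ := mem_meets_iff.1 hold
      have : s ∈ a' ∩ b₁ := by rw [heq]; exact mem_inter.2 ⟨hsb hd, hsb hd'⟩
      exact hsa' (mem_inter.1 this).1
    have h := uniq hZ hZ'
    have : s ∈ a' ∩ b₁ := by rw [← h]; exact mem_inter.2 ⟨hsa, hsb hb₁⟩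
    exact hsa' (mem_inter.1 this).1
  -- (iii-b) a cross coincidence `a ∪ b = a' ∪ b'` with `b ≠ b'` makes `a` swallow `U \ b` (and `a'` swallow `U \ b'`)
  have crossSw : ∀ {g g' b b' : Finset α}, b ∈ below P r → b' ∈ below P r → b ≠ b' → g ∪ b = g' ∪ b' → U \ b ⊆ g := by
    intro g g' b b' hb hb' hbb' heq x hx
    have hxb' : x ∈ b' := sdiff_subset_of_below_cosunflower hU hb hb' hbb' hx
    have : x ∈ g ∪ b := by rw [heq]; exact mem_union_right _ hxb'
    rcases mem_union.1 this with h | h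
    · exact h
    · exact absurd h (mem_sdiff.1 hx).2
  -- (iii) the two rows of cross joins are not equal as sets
  set IA := (below P r).image (fun b => a ∪ b) with hIA
  set IA' := (below P r).image (fun b => a' ∪ b) with hIA'
  have rows_ne : IA ≠ IA' := by
    intro hEq
    -- every `a ∪ b` equals some `a' ∪ b'`, and vice versa
    have fwd : ∀ {b : Finset α}, b ∈ below P r → ∃ b' ∈ below P r, a ∪ b = a' ∪ b' := by
      intro b hb
      have : a ∪ b ∈ IA' := by rw [← hEq]; exact mem_image_of_mem _ hb
      obtain ⟨b', hb', h⟩ := mem_image.1 this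
      exact ⟨b', hb', h.symm⟩
    have bwd : ∀ {b : Finset α}, b ∈ below P r → ∃ b' ∈ below P r, a' ∪ b = a ∪ b' := by
      intro b hb
      have : a' ∪ b ∈ IA := by rw [hEq]; exact mem_image_of_mem _ hb
      obtain ⟨b', hb', h⟩ := mem_image.1 this
      exact ⟨b', hb', h.symm⟩
    -- some `b₀` is matched to a different member (else all are diagonal)
    have : ∃ b₀ ∈ below P r, ∃ b₀' ∈ below P r, b₀ ≠ b₀' ∧ a ∪ b₀ = a' ∪ b₀' := by
      by_contra hnone
      push Not at hnone
      apply notAllD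
      intro b hb
      obtain ⟨b', hb', h⟩ := fwd hb
      by_cases hbb : b = b'
      · rw [hbb] at h ⊢; exact h
      · exact absurd h (hnone b hb b' hb' hbb)
    obtain ⟨b₀, hb₀, b₀', hb₀', hne₀, h₀⟩ := this
    have swA : U \ b₀ ⊆ a := crossSw hb₀ hb₀' hne₀ h₀
    have swA' : U \ b₀' ⊆ a' := crossSw hb₀' hb₀ hne₀.symm h₀.symm
    -- every other member `b ≠ b₀` must be matched diagonally for `a` (else a second co-petal inside `a`)
    have diagA : ∀ {b : Finset α}, b ∈ below P r → b ≠ b₀ → a ∪ b = a' ∪ b := by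
      intro b hb hbb₀
      obtain ⟨b', hb', h⟩ := fwd hb
      by_cases hbb' : b = b'
      · rw [hbb'] at h ⊢; exact h
      · exfalso
        have sw2 : U \ b ⊆ a := crossSw hb hb' hbb' h
        obtain ⟨c, hc, hcb, hcb₀⟩ := exists_third (by omega : 3 ≤ #(below P r)) b b₀
        exact swallow2 ha hb hb₀ hc hbb₀ hcb.symm hcb₀.symm sw2 swA
    -- in particular for `b₀'`: `a ∪ b₀' = a' ∪ b₀' = ...`; and for `b₀` via the `a'` row
    have diagA' : ∀ {b : Finset α}, b ∈ below P r → b ≠ b₀' → a' ∪ b = a ∪ b := by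
      intro b hb hbb₀'
      obtain ⟨b', hb', h⟩ := bwd hb
      by_cases hbb' : b = b'
      · rw [hbb'] at h ⊢; exact h
      · exfalso
        have sw2 : U \ b ⊆ a' := crossSw hb hb' hbb' h
        obtain ⟨c, hc, hcb, hcb₀'⟩ := exists_third (by omega : 3 ≤ #(below P r)) b b₀'
        exact swallow2 ha' hb hb₀' hc hbb₀' hcb.symm hcb₀'.symm sw2 swA'
    -- now `a ∪ b₀ = a' ∪ b₀` (from the `a'` row, since `b₀ ≠ b₀'`), contradicting the choice unless all are diagonal
    apply notAllD
    intro b hb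
    by_cases hbb₀ : b = b₀
    · rw [hbb₀]; exact (diagA' hb₀ hne₀).symm
    · exact diagA hb hbb₀
  -- (iv) count
  have injA : Set.InjOn (fun b => a ∪ b) (below P r : Set (Finset α)) := by
    intro b hb b' hb' h; by_contra hbb; exact rowdist ha (mem_coe.1 hb) (mem_coe.1 hb') hbb h
  have injA' : Set.InjOn (fun b => a' ∪ b) (below P r : Set (Finset α)) := by
    intro b hb b' hb' h; by_contra hbb; exact rowdist ha' (mem_coe.1 hb) (mem_coe.1 hb') hbb h
  have cA : #IA = 3 := by rw [hIA, card_image_of_injOn injA, h3]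
  have cA' : #IA' = 3 := by rw [hIA', card_image_of_injOn injA', h3]
  -- two distinct 3-sets cover at least four sets
  have h4 : 4 ≤ #(IA ∪ IA') := by
    by_contra hlt
    have hle : #(IA ∪ IA') ≤ 3 := by omega
    have e1 : IA = IA ∪ IA' := eq_of_subset_of_card_le subset_union_left (by omega)
    have e2 : IA' = IA ∪ IA' := eq_of_subset_of_card_le subset_union_right (by omega)
    exact rows_ne (e1.trans e2.symm)
  have hsub : (IA ∪ IA').erase (a ∪ a') ⊆ newJoins P r := by
    intro W hW
    obtain ⟨hWu, hW⟩ := mem_erase.1 hW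
    rcases mem_union.1 hW with hW | hW
    · obtain ⟨b, hb, rfl⟩ := mem_image.1 hW
      rw [union_mem_newJoins_iff ha hb, hJ, mem_singleton]; exact hWu
    · obtain ⟨b, hb, rfl⟩ := mem_image.1 hW
      rw [union_mem_newJoins_iff ha' hb, hJ, mem_singleton]; exact hWu
  have := card_le_card hsub
  have h5 := pred_card_le_card_erase (s := IA ∪ IA') (a := a ∪ a')
  omega

end Summit.CriticalPhenomena.PercolationContinuityZ3.Theorems.SahiColouredDaykin
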